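import Literature.NumberTheory.GaloisCohomology.Howard2004.DVRSettingEngineLiftProofs
import Literature.NumberTheory.GaloisCohomology.Howard2004.DVRSettingEngineRedProofs
import HarnessLib

/-!
# Howard 2004, Lemma 1.6.4 on a `DVRSetting`: the ENGINE's `hlift` in the engine's own letters
# (`kappaSel`, `redSel`, `stub`, `stubLength - 1`) on a full tower (theorems only)

Topic `NumberTheory/GaloisCohomology/Howard2004`; namespace `Literature.NumberTheory.GaloisCohomology.Howard2004`.
THEOREMS ONLY: no definition, no named fact, no instance, no notation, no `sorry`.  Sequel to
`DVRSettingEngineLiftProofs` (the liftability case `DVRSetting.mem_stub_of_redLE_eq_zero`, seat x10b-p1-w7 g9) and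
`DVRSettingEngineRedProofs` (LEAD g12: the engine letters `redLEH1` / `redSel` / `kappaSel`, and
`redIterH1_kappaR` = «`κ^{(i)}_n` is the reduction of `κ^{(k)}_n`» under the guard `n ∈ 𝓝(𝓛^{(2k-1)})`).

WHY (INPUTS row G87 = `Howard2004.thm161_dvrKolyvaginBound` = Howard Thm. 1.6.1; stub `stub_h161` of the μ-crux
stmt-BirchSwinnertonDyer-22642; cell `pub/bsd-print-x9`, brick (ENGINE-hlift), adapter).  The engine
`mem_stub_of_stubLemmaInduction_levels'` / `…_guarded` is instantiated (w2 g16 / LEAD g12) with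
`P := S.enginePrimes`, `H k n := ↥(S.selmerModuleAt hy k n)`, `κ := S.kappaSel hy κ pins`, `Stub := S.stub hy hdec`,
`lam k n := S.stubLength hy hdec k n - 1` (the level INDEX of exponent `λ^{(k)}(n)` on a full tower `e_i = i + 1`),
`red := S.redSel hy`.  Its hypothesis

  `hlift : ∀ k n, ↑n ⊆ P k → Stub k n ≠ ⊥ → Stub k n ≠ ⊤ → red k (lam k n) n (κ k n) = 0 → κ k n ∈ Stub k n`

(Lemma 1.6.4, first case: arXiv:1202.6340 p. 11 L85 – p. 12 L9) is delivered here VERBATIM: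

* §1 **`DVRSetting.redIterH1_kappaR_of_subset_levelPrimes`** / `redLEH1_kappaR_of_subset_levelPrimes` — LEAD g12's
  `redIterH1_kappaR` under Howard's weaker guard `n ∈ 𝓝^{(i+d)} = 𝓝(𝓛 ∩ 𝓛_{e_{i+d}})` (its proof uses only
  `ker π^{(i+d)}_n = 0`, i.e. `I_n T^{(i+d)} = 0`, which `ker_π_eq_bot_of_subset_levelPrimes` supplies): the first case
  reads `κ^{(k)}_n` as the reduction of `κ^{(2k-1)}_n` for `n ∈ 𝓝(𝓛^{(2k-1)})`, and `𝓛^{(2k-1)} = levelPrimes` of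
  the level of exponent `2e_k - 1`, NOT `enginePrimes` of that level;
* §2 `stubLength_pos_of_stub_ne_top` (`Stub ≠ H ⇒ 1 ≤ λ`), `stubLength_lt_e_of_stub_ne_bot'` (`Stub ≠ 0 ⇒ λ < e_k`:
  `π^{e_k}` kills the level) — the range of Howard's `i = λ^{(k)}(n)`;
* §3 **`DVRSetting.kappaSel_mem_stub_of_redSel_eq_zero`** — `hlift` verbatim on a FULL tower (`hfull : ∀ i, e_i = i + 1`;
  the settings of `thm161_of_full_tame` / `S.refine`), given the engine's decomposition hypothesis `hdec`
  (`HasLevelDecompositions`, feeding `stub` / `stubLength`) and Thm. 1.4.2 under Howard's own key `hdecAt`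
  (`HasLevelDecompositionsAt`, used at the auxiliary level `2k` of exponent `2e_k - 1 = 2k + 1`).

HONEST FRAMING: Lemma 1.6.4, Thm. 1.6.1 and `thm161_dvrKolyvaginBound` are NOT proved here (Thm. 1.4.2 is an input;
`hKS`, `h159`, `hsmall`, `hlam`, `hchebI/II` are other bricks); no summit statement is proved; the Birch–Swinnerton-Dyer
conjecture is not proved by any of this.
References: [Howard2004HeegnerKolyvagin] Lemma 1.6.4 (proof, first case), Lemma 1.6.3, Def. 1.2.3, Def. 1.5.4, §1.6
(arXiv:1202.6340 p. 11 L85 – p. 12 L9, p. 11 L69–80, p. 7 L1–12, p. 10 L56–60, p. 11 L33–38); [MazurRubinMemoirs2004] Prop. 4.5.8.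
-/

set_option autoImplicit false

noncomputable section

open Function NumberField IsDedekindDomain Field
open scoped NumberField ContRepresentation Classical TensorProduct

namespace Literature.NumberTheory.GaloisCohomology.Howard2004

open Literature.NumberTheory.GaloisRepresentations
open Literature.NumberTheory.GaloisRepresentations.DiscreteGaloisModule
open Literature.NumberTheory.GaloisRepresentations.galoisCohomology

namespace DVRSetting

variable {p : ℕ} [Fact p.Prime] {K : Type} [Field K] [NumberField K]
  {R : Type} [CommRing R] [IsDomain R] [IsDiscreteValuationRing R] [Algebra ℤ_[p] R]
  {N : ℕ → Type} [∀ k, AddCommGroup (N k)] [∀ k, TopologicalSpace (N k)]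
  [∀ k, DiscreteTopology (N k)] [∀ k, Module R (N k)]
  {Rk : ℕ → Type} [∀ k, CommRing (Rk k)] [∀ k, IsLocalRing (Rk k)] [∀ k, TopologicalSpace (Rk k)]
  [∀ k, DiscreteTopology (Rk k)] [∀ k, Algebra ℤ_[p] (Rk k)] [∀ k, Algebra R (Rk k)]
  [∀ k, Module (Rk k) (N k)] [∀ k, IsScalarTower R (Rk k) (N k)]
  {Nbar : Type} [AddCommGroup Nbar] [TopologicalSpace Nbar] [DiscreteTopology Nbar]
  [∀ k, Module (Rk k) Nbar]
  {Nq : ℕ → Finset (HeightOneSpectrum (𝓞 K)) → Type} [∀ k n, AddCommGroup (Nq k n)]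
  [∀ k n, TopologicalSpace (Nq k n)] [∀ k n, DiscreteTopology (Nq k n)]
  [∀ k n, Module (Rk k) (Nq k n)] [∀ k n, Module R (Nq k n)]
  [∀ k n, IsScalarTower R (Rk k) (Nq k n)]

/-! ## §1 `κ^{(i)}_n = red κ^{(i+d)}_n` under Howard's guard `n ∈ 𝓝^{(i+d)}` -/

/-- **`H¹(redIter_{i,d})(κ (i+d) n) = κ i n` for `n ∈ 𝓝^{(i+d)} = 𝓝(𝓛 ∩ 𝓛_{e_{i+d}}(T))`** — LEAD g12's
`redIterH1_kappaR` (same proof: `κ_redIter`, the square `rqIter ∘ π^{(i+d)}_n = π^{(i)}_n ∘ redIter`, uniqueness of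
`kappaR`) under the weaker, printed guard: it only needs `ker π^{(i+d)}_n = 0` (`I_n T^{(i+d)} = 0`), which holds on
`𝓝^{(i+d)}` (`ker_π_eq_bot_of_subset_levelPrimes`).  The liftability case uses it with `i + d` the level of exponent
`2e_i - 1` and `n ∈ 𝓝(𝓛^{(2i-1)}) = 𝓝^{(i+d)}`.
[cite: Howard2004HeegnerKolyvagin, Def. 1.2.3 and Lemma 1.6.4 proof, first case (arXiv p. 7 L1–12, p. 11 L85 – p. 12 L1: «κ^{(k)}_n ∈ image of H¹_{F(n)}(K,T^{(2k-1)})»)] -/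
theorem redIterH1_kappaR_of_subset_levelPrimes (S : DVRSetting p K R N Rk Nbar Nq) (hy : S.SatisfiesH)
    (κ : S.KolyvaginSystem) (pins : ∀ v : HeightOneSpectrum (𝓞 K), TamePin v) (i d : ℕ)
    {n : Finset (HeightOneSpectrum (𝓞 K))} (hn : ↑n ⊆ S.levelPrimes (i + d)) :
    S.T.redIterH1 i d (S.kappaR κ pins (i + d) n) = S.kappaR κ pins i n := by
  have hni : ↑n ⊆ S.levelPrimes i := hn.trans (S.levelPrimes_antitone hy (Nat.le_add_right i d))
  have hker' := S.ker_π_eq_bot_of_subset_levelPrimes hy (i + d) hn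
  have hker := S.ker_π_eq_bot_of_subset_levelPrimes hy i hni
  have hlev' : n ∈ (S.t (i + d)).levelSet := S.mem_levelSet_of_subset_levelPrimes hy (i + d) (i + d) hn
  have hlev : n ∈ (S.t i).levelSet := S.mem_levelSet_of_subset_levelPrimes hy (i + d) i hn
  -- the square `rqIter ∘ π^{(i+d)}_n = π^{(i)}_n ∘ redIter` on `H¹`
  have hsq : ∀ a : galoisCohomology (S.T.ρ (i + d)) 1,
      S.toCoeffTowerSetting.rqIterH1 i n d (((S.LD (i + d)).isQuotientBy n).cohomologyMap 1 a) =
        ((S.LD i).isQuotientBy n).cohomologyMap 1 (S.T.redIterH1 i d a) := fun a =>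
    cohomologyMap_one_comm_sq (S.T.ρ (i + d)) ((S.LD (i + d)).ρq n) (S.T.ρ i) ((S.LD i).ρq n)
      ((S.LD (i + d)).π n).toAddMonoidHom ((S.LD (i + d)).isQuotientBy n).equivariant
      (S.toCoeffTowerSetting.rqIter i n d).toAddMonoidHom (S.toCoeffTowerSetting.rqIter_equivariant i n d)
      (S.T.redIter i d).toAddMonoidHom (S.T.redIter_equivariant i d)
      ((S.LD i).π n).toAddMonoidHom ((S.LD i).isQuotientBy n).equivariant
      (fun x => S.toCoeffTowerSetting.rqIter_comp i n d x) a
  -- `(rqIterH1 ∘ subtype) ⊗ 1 = (rqIterH1 ⊗ 1) ∘ (subtype ⊗ 1)`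
  have hB : TensorProduct.map ((S.toCoeffTowerSetting.rqIterH1 i n d).comp
        ((S.toCoeffTowerSetting.LD (i + d)).selmerAt S.toCoeffTowerSetting.jbar n).subtype).toIntLinearMap
        (LinearMap.id : Gn (K := K) n →ₗ[ℤ] Gn (K := K) n) =
      TensorProduct.map (S.toCoeffTowerSetting.rqIterH1 i n d).toIntLinearMap LinearMap.id ∘ₗ
        TensorProduct.map ((S.toCoeffTowerSetting.LD (i + d)).selmerAt S.toCoeffTowerSetting.jbar n
          ).subtype.toIntLinearMap (LinearMap.id : Gn (K := K) n →ₗ[ℤ] Gn (K := K) n) := by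
    rw [← TensorProduct.map_comp, LinearMap.comp_id]
    rfl
  -- `κ_red` iterated (`κ_redIter`), the defining identity of `kappaR` at level `i + d`, and the square
  have h2 : TensorProduct.map ((S.LD i).selmerAt S.jbar n).subtype.toIntLinearMap LinearMap.id (κ.κ i n) =
      ((S.LD i).isQuotientBy n).cohomologyMap 1 (S.T.redIterH1 i d (S.kappaR κ pins (i + d) n)) ⊗ₜ[ℤ]
        (PiTensorProduct.tprod ℤ fun q : ↥n => (pins q).gbar : Gn (K := K) n) :=
    calc TensorProduct.map ((S.LD i).selmerAt S.jbar n).subtype.toIntLinearMap LinearMap.id (κ.κ i n)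
        = TensorProduct.map ((S.toCoeffTowerSetting.rqIterH1 i n d).comp
            ((S.toCoeffTowerSetting.LD (i + d)).selmerAt S.toCoeffTowerSetting.jbar n).subtype).toIntLinearMap
            (LinearMap.id : Gn (K := K) n →ₗ[ℤ] Gn (K := K) n) ((KolyvaginSystem.toCoeff κ).κ (i + d) n) :=
          (CoeffTowerSetting.KolyvaginSystem.κ_redIter (KolyvaginSystem.toCoeff κ) i n d).symm
      _ = TensorProduct.map (S.toCoeffTowerSetting.rqIterH1 i n d).toIntLinearMap LinearMap.id
            (TensorProduct.map ((S.toCoeffTowerSetting.LD (i + d)).selmerAt S.toCoeffTowerSetting.jbar n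
              ).subtype.toIntLinearMap (LinearMap.id : Gn (K := K) n →ₗ[ℤ] Gn (K := K) n)
              ((KolyvaginSystem.toCoeff κ).κ (i + d) n)) := LinearMap.congr_fun hB _
      _ = TensorProduct.map (S.toCoeffTowerSetting.rqIterH1 i n d).toIntLinearMap LinearMap.id
            (((S.LD (i + d)).isQuotientBy n).cohomologyMap 1 (S.kappaR κ pins (i + d) n) ⊗ₜ[ℤ]
              (PiTensorProduct.tprod ℤ fun q : ↥n => (pins q).gbar : Gn (K := K) n)) :=
          congrArg _ (S.map_subtype_κ_eq_kappaR_tmul κ pins (i + d) hker' hlev')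
      _ = S.toCoeffTowerSetting.rqIterH1 i n d
            (((S.LD (i + d)).isQuotientBy n).cohomologyMap 1 (S.kappaR κ pins (i + d) n)) ⊗ₜ[ℤ]
              (PiTensorProduct.tprod ℤ fun q : ↥n => (pins q).gbar : Gn (K := K) n) := TensorProduct.map_tmul _ _ _ _
      _ = _ := congrArg (· ⊗ₜ[ℤ] (PiTensorProduct.tprod ℤ fun q : ↥n => (pins q).gbar : Gn (K := K) n))
          (hsq (S.kappaR κ pins (i + d) n))
  exact S.eq_kappaR_of_tmul_eq κ pins i hker hlev h2

/-- **`H¹(redLE_{i ≤ k})(κ k n) = κ i n` for `n ∈ 𝓝^{(k)}`** (Howard's guard).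
[cite: Howard2004HeegnerKolyvagin, Def. 1.2.3 and Lemma 1.6.4 proof, first case (arXiv p. 7 L1–12, p. 11 L85 – p. 12 L1)] -/
theorem redLEH1_kappaR_of_subset_levelPrimes (S : DVRSetting p K R N Rk Nbar Nq) (hy : S.SatisfiesH)
    (κ : S.KolyvaginSystem) (pins : ∀ v : HeightOneSpectrum (𝓞 K), TamePin v) {i k : ℕ} (h : i ≤ k)
    {n : Finset (HeightOneSpectrum (𝓞 K))} (hn : ↑n ⊆ S.levelPrimes k) :
    S.redLEH1 h (S.kappaR κ pins k n) = S.kappaR κ pins i n := by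
  obtain ⟨d, rfl⟩ := Nat.exists_eq_add_of_le h
  rw [S.redLEH1_eq_redIterH1 i d h]
  exact S.redIterH1_kappaR_of_subset_levelPrimes hy κ pins i d hn

/-! ## §2 The range of `i = λ^{(k)}(n)`: `Stub ≠ H ⇒ 1 ≤ λ`, `Stub ≠ 0 ⇒ λ < e_k` -/

/-- **`Stub^{(k)}(n) ≠ H¹_{F(n)}(K, T^{(k)}) ⇒ 1 ≤ λ^{(k)}(n)`** (`𝔪^0 H = H`).
[cite: Howard2004HeegnerKolyvagin, Def. 1.5.4 and Lemma 1.6.4 proof, first case (arXiv p. 10 L56–60, p. 11 L85–88)] -/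
theorem stubLength_pos_of_stub_ne_top (S : DVRSetting p K R N Rk Nbar Nq) (hy : S.SatisfiesH)
    (hdec : S.HasLevelDecompositions hy) (k : ℕ) (n : Finset (HeightOneSpectrum (𝓞 K)))
    (htop : letI := galoisCohomology.moduleH1 (S.T.ρ k) (S.T.hlin k); S.stub hy hdec k n ≠ ⊤) :
    1 ≤ S.stubLength hy hdec k n := by
  letI := galoisCohomology.moduleH1 (S.T.ρ k) (S.T.hlin k)
  rcases Nat.eq_zero_or_pos (S.stubLength hy hdec k n) with h0 | hpos
  · exfalso
    refine htop (eq_top_iff.mpr fun x _ => (S.mem_stub_iff hy hdec k n x).mpr ⟨x, ?_⟩)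
    rw [h0, pow_zero, one_smul]
  · exact hpos

/-- **`Stub^{(k)}(n) ≠ 0 ⇒ λ^{(k)}(n) < e_k`** (`π^{e_k}` kills `H¹(K, T^{(k)})`): «First suppose `Stub^{(k)}(n) ≠ 0`, so
that … `λ^{(k)}(n) < k`.» [cite: Howard2004HeegnerKolyvagin, Lemma 1.6.4 proof, first case (arXiv p. 11 L85–88)] -/
theorem stubLength_lt_e_of_stub_ne_bot' (S : DVRSetting p K R N Rk Nbar Nq) (hy : S.SatisfiesH)
    (hdec : S.HasLevelDecompositions hy) (k : ℕ) (n : Finset (HeightOneSpectrum (𝓞 K)))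
    (hbot : letI := galoisCohomology.moduleH1 (S.T.ρ k) (S.T.hlin k); S.stub hy hdec k n ≠ ⊥) :
    S.stubLength hy hdec k n < S.e k := by
  letI := galoisCohomology.moduleH1 (S.T.ρ k) (S.T.hlin k)
  by_contra hge
  refine hbot (eq_bot_iff.mpr fun x hx => ?_)
  obtain ⟨y, hyx⟩ := (S.mem_stub_iff hy hdec k n x).mp hx
  rw [Submodule.mem_bot, ← hyx]
  exact Subtype.ext (S.scalarMapH1_pow_eq_zero_of_le hy k (Nat.not_lt.mp hge) (y : galoisCohomology (S.T.ρ k) 1))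

/-! ## §3 The ENGINE's `hlift`, verbatim, on a full tower -/

/-- **Howard 2004, Lemma 1.6.4, first case = the ENGINE's `hlift`, VERBATIM in the engine's letters on a FULL tower
(`e_i = i + 1`).**  With `P := S.enginePrimes`, `κ := S.kappaSel hy κ pins`, `Stub := S.stub hy hdec`,
`lam k n := S.stubLength hy hdec k n - 1`, `red := S.redSel hy`:
`∀ k n, ↑n ⊆ P k → Stub k n ≠ ⊥ → Stub k n ≠ ⊤ → red k (lam k n) n (κ k n) = 0 → κ k n ∈ Stub k n`.
Inputs: the engine's decomposition hypothesis `hdec` (for `stub`/`stubLength`) and Thm. 1.4.2 under Howard's key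
`hdecAt` (`HasLevelDecompositionsAt`), read at the auxiliary level `2k` of exponent `2k + 1 = 2e_k - 1` for
`n ∈ 𝓝(𝓛^{(2k-1)}) = 𝓝^{(2k)}`.  Proof: `i := λ - 1` has `e_i = λ` (`1 ≤ λ`, §2) and `i ≤ k` (`λ < e_k`, §2);
`κ^{(k)}_n = red κ^{(2k)}_n` (§1); `red_{k→i} κ^{(k)}_n = 0` is the hypothesis; conclude by
`DVRSettingEngineLiftProofs.mem_stub_of_redLE_eq_zero`.
[cite: Howard2004HeegnerKolyvagin, Lemma 1.6.4 proof, first case, with Lemma 1.6.3 (arXiv:1202.6340 p. 11 L85 – p. 12 L9; p. 11 L69–80)]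
[cite: MazurRubinMemoirs2004, Prop. 4.5.8] -/
theorem kappaSel_mem_stub_of_redSel_eq_zero (S : DVRSetting p K R N Rk Nbar Nq) (hy : S.SatisfiesH)
    (hdec : S.HasLevelDecompositions hy) (hdecAt : S.HasLevelDecompositionsAt hy) (hfull : ∀ i, S.e i = i + 1)
    (κ : S.KolyvaginSystem) (pins : ∀ v : HeightOneSpectrum (𝓞 K), TamePin v) :
    letI := fun k => galoisCohomology.moduleH1 (S.T.ρ k) (S.T.hlin k)
    ∀ (k : ℕ) (n : Finset (HeightOneSpectrum (𝓞 K))), ↑n ⊆ S.enginePrimes k →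
      S.stub hy hdec k n ≠ ⊥ → S.stub hy hdec k n ≠ ⊤ →
      S.redSel hy k (S.stubLength hy hdec k n - 1) n (S.kappaSel hy κ pins k n) = 0 →
      S.kappaSel hy κ pins k n ∈ S.stub hy hdec k n := by
  intro k n hn hbot htop h0
  letI := galoisCohomology.moduleH1 (S.T.ρ k) (S.T.hlin k)
  have h1 : 1 ≤ S.stubLength hy hdec k n := S.stubLength_pos_of_stub_ne_top hy hdec k n htop
  have hlt : S.stubLength hy hdec k n < S.e k := S.stubLength_lt_e_of_stub_ne_bot' hy hdec k n hbot
  have hek := hfull k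
  -- Howard's `i = λ^{(k)}(n)`: the level INDEX `λ - 1` of exponent `λ`
  have hik : S.stubLength hy hdec k n - 1 ≤ k := by omega
  have hei : S.e (S.stubLength hy hdec k n - 1) = S.stubLength hy hdec k n := by rw [hfull]; omega
  -- the auxiliary level `2k` of exponent `2e_k - 1`
  have hd : S.e (k + k) + 1 = 2 * S.e k := by rw [hfull, hfull]; omega
  have hnj : ↑n ⊆ S.levelPrimes (k + k) :=
    hn.trans (S.enginePrimes_subset_levelPrimes_of_e_le (by rw [hfull, hfull]; omega))
  obtain ⟨ε', _, M', _, _, _, θ', hθ'⟩ := hdecAt (k + k) n hnj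
  -- `red_{k→i} κ^{(k)}_n = 0`
  have h0' : S.redLEH1 hik (S.kappaR κ pins k n) = 0 := by
    have h := congrArg Subtype.val h0
    rw [S.coe_redSel_apply hy hik n, coe_kappaSel] at h
    exact h
  -- `κ^{(k)}_n = red κ^{(2k)}_n`
  have hxc' : S.kappaR κ pins k n = S.redLEH1 (Nat.le_add_right k k) (S.kappaR κ pins (k + k) n) :=
    (S.redLEH1_kappaR_of_subset_levelPrimes hy κ pins (Nat.le_add_right k k) hnj).symm
  exact S.mem_stub_of_redLE_eq_zero hy hdec k k hd hn θ' hθ' (S.kappaR_mem_selmerGroup_atLevel κ pins k n)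
    (S.kappaR_mem_selmerGroup_atLevel κ pins (k + k) n) hxc' hik hei h0'

end DVRSetting

end Literature.NumberTheory.GaloisCohomology.Howard2004

end
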